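import Literature.RepresentationTheory.HeisenbergGroup.StoneVonNeumannLatticePairIrreducible
import Literature.RepresentationTheory.HeisenbergGroup.WeylSystemCommutingAction
import HarnessLib

/-!
# Irreducibility CRITERIA for a Weyl system, alone or commuting with a lattice-pair Heisenberg group:
# a cyclic vacuum (resp. vacuum and lattice-fixed) vector forces irreducibility

Topic `RepresentationTheory/HeisenbergGroup`; namespace `Literature.RepresentationTheory.HeisenbergGroup`.  KERNEL ONLY:
theorems; no definition, no named fact, no record, no `sorry`.

`(V, J, W)` a Weyl system on a complex Hilbert space `E` (`IsWeylSystem`, [vonNeumann1931, §4–5], [Folland1989, §1.5]) with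
Gaussian projection `P` and vacuum subspace `M₀` (`WeylSystemVacuumProjection.lean`, `WeylSystemVacuumSubspace.lean`).

* §1 **`mem_vacuumSubspace_of_inner_apply_self`** — the converse of `inner_apply_self_of_vacuumVec_eq`: a vector
  whose diagonal coefficient is the Gaussian, `⟪W(z) v, v⟫ = e^{-(π/2)‖z‖²} ⟪v, v⟫`, IS a vacuum vector (`P v = v`), because
  `⟪P v, v⟫ = ∫ γ² ‖v‖² = ‖v‖² = ‖P v‖²` forces `‖P v - v‖ = 0`; with `integral_gauss_mul_gauss` (`∫ γ² = 1`).  This is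
  how a CONCRETE vector (the Gaussian of `L²(ℝⁿ)`, the Gaussian ⊗ `1_{𝒪̂ⁿ}` of `L²` of the adèles) is recognised as a
  vacuum vector without evaluating a Bochner integral.
* §2 (Weyl system alone) **`vacuum_eq_smul_of_dense_span`**, **`irreducible_of_dense_span_vacuum`** — if a vacuum vector
  `v₀` is CYCLIC (`span {W(x) v₀}` dense) then `M₀ = ℂ v₀` and `E` has no closed `W`-invariant subspace other than `⊥`,
  `⊤` (von Neumann: irreducible ⟺ `dim M₀ = 1`; here the usable direction, from one explicit orbit).
* §3 (Weyl system commuting with an isometric `ψ`-representation `τ` of a lattice-pair Heisenberg group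
  `Heisenberg (polar β)`, dual lattice pair `(B₁, B₂)`, as in `WeylSystemLatticePairUniqueness.lean` — the SHAPE of the
  adelic `ρ_ψ` of [GelbartRogawski1991, §3.1 p. 454 L19–21], archimedean Weyl system ⊗ finite-adelic Heisenberg group)
  **`vacuum_latticeFixed_eq_smul_of_dense_span`**, **`irreducible_of_dense_span_vacuum_latticeFixed`** — if a vector
  `v₀` which is BOTH a `W`-vacuum vector AND `τ`-lattice-fixed is jointly cyclic (`span {W(x) τ(h) v₀}` dense), then every
  such vector is a multiple of `v₀`, and `E` has no closed subspace invariant under all `W(x)` and all `τ(h)` other than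
  `⊥`, `⊤`.  Proof: the orthogonal projection onto a closed jointly invariant `K` commutes with `W` and `τ`, so `P_K v₀`
  is again vacuum (`mem_vacuumSubspace_of_commute`) and lattice-fixed, hence `c • v₀` by the forced coefficients
  `⟪W(x) τ(h) v₀, u⟫ = γ(x) (1_{B₁×B₂} ψ̄)(h) ⟪v₀, u⟫` (`inner_apply_of_mem_vacuumSubspace`,
  `inner_apply_latticeFixed_latticeFixed`); `c ≠ 0` puts the dense orbit span in `K`, `c = 0` puts it in `Kᗮ`.

This is the criterion by which the joint irreducibility of the `L²` model of the adelic Heisenberg representation reduces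
to the density of the orbit of ONE explicit vector.  Nothing of the cited sources is asserted; everything is proved.

## References
* [vonNeumann1931] J. von Neumann, *Die Eindeutigkeit der Schrödingerschen Operatoren*, Math. Ann. 104 (1931) 570–578, §4–5.
* [Folland1989] G. B. Folland, *Harmonic Analysis in Phase Space*, Princeton UP 1989, §1.5 Theorem (1.50) and its proof.
* [MoeglinVignerasWaldspurger1987] C. Mœglin, M.-F. Vignéras, J.-L. Waldspurger, LNM 1291 (1987), Chap. 2 I.6, I.8.
* [GelbartRogawski1991] S. Gelbart, J. Rogawski, Invent. Math. 105 (1991), §3.1 p. 454 L19–21.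
-/

set_option autoImplicit false

noncomputable section

open MeasureTheory Complex Filter Set
open scoped InnerProductSpace ComplexConjugate Topology

namespace Literature.RepresentationTheory.HeisenbergGroup

variable {V : Type*} [NormedAddCommGroup V] [InnerProductSpace ℝ V] [FiniteDimensional ℝ V]
  [MeasurableSpace V] [BorelSpace V]
variable {E : Type*} [NormedAddCommGroup E] [InnerProductSpace ℂ E] [CompleteSpace E]

namespace IsWeylSystem

variable {J : V →ₗ[ℝ] V} {W : V → E →L[ℂ] E}

/-! ## §1 Gaussian diagonal coefficient ⇒ vacuum vector -/

omit [CompleteSpace E] in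
/-- `∫ γ(z)² dz = 1` (the case `w = y = 0` of `integral_gauss_mul_gauss_mul_fourierChar`; `γ(z) = e^{-(π/2)‖z‖²}`).
[cite: Folland1989, §1.5 proof of Theorem (1.50)] -/
theorem integral_gauss_mul_gauss (hW : IsWeylSystem J W) : ∫ z : V, (gauss z : ℂ) * gauss z = 1 := by
  have h := integral_gauss_mul_gauss_mul_fourierChar hW.inner_J_left hW.norm_J (0 : V) (0 : V)
  simp only [sub_zero, zero_sub, gauss_neg, map_zero, inner_zero_right, zero_div, AddChar.map_zero_eq_one,
    Circle.coe_one, mul_one, gauss_zero, Complex.ofReal_one] at h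
  exact h

/-- **a vector with Gaussian diagonal coefficient is a vacuum vector**: if `⟪W(z) v, v⟫ = γ(z) ‖v‖²` for all `z`, then
`P v = v`, i.e. `v ∈ M₀` (converse of `inner_apply_self_of_vacuumVec_eq`): `⟪P v, v⟫ = ∫ γ(z) ⟪W(z) v, v⟫ = ‖v‖²`
and `‖P v‖² = ⟪P² v, v⟫ = ⟪P v, v⟫`, so `‖P v - v‖² = ‖P v‖² - 2 Re ⟪P v, v⟫ + ‖v‖² = 0`.
[cite: vonNeumann1931, §5; Folland1989, §1.5 proof of Theorem (1.50)] -/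
theorem mem_vacuumSubspace_of_inner_apply_self (hW : IsWeylSystem J W) {v : E}
    (h : ∀ z : V, ⟪W z v, v⟫_ℂ = (gauss z : ℂ) * ⟪v, v⟫_ℂ) : v ∈ hW.vacuumSubspace := by
  rw [hW.mem_vacuumSubspace]
  have hPv : ⟪vacuumVec W v, v⟫_ℂ = ⟪v, v⟫_ℂ := by
    rw [hW.inner_vacuumVec_left]
    simp_rw [h, ← mul_assoc]
    rw [integral_mul_const, hW.integral_gauss_mul_gauss, one_mul]
  have hPP : ⟪vacuumVec W v, vacuumVec W v⟫_ℂ = ⟪v, v⟫_ℂ := by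
    rw [← hW.inner_vacuumVec_comm, hW.vacuumVec_vacuumVec, hPv]
  have e : ⟪vacuumVec W v - v, vacuumVec W v - v⟫_ℂ = 0 := by
    rw [inner_sub_left, inner_sub_right, inner_sub_right, hPP, hPv, ← inner_conj_symm v (vacuumVec W v), hPv,
      inner_self_conj]
    simp
  rwa [inner_self_eq_zero, sub_eq_zero] at e

/-! ## §2 A Weyl system with a cyclic vacuum vector is irreducible -/

omit [FiniteDimensional ℝ V] [MeasurableSpace V] [BorelSpace V] [CompleteSpace E] in
/-- `Kᗮ` is `W`-invariant when `K` is (`W(x)† = W(-x)`). [cite: vonNeumann1931, §5] -/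
theorem apply_mem_orthogonal_of_invariant (hW : IsWeylSystem J W) {K : Submodule ℂ E}
    (hKW : ∀ (x : V), ∀ v ∈ K, W x v ∈ K) (x : V) {w : E} (hw : w ∈ Kᗮ) : W x w ∈ Kᗮ := by
  rw [Submodule.mem_orthogonal] at hw ⊢
  intro k hk
  rw [hW.inner_apply_right]
  exact hw _ (hKW (-x) k hk)

omit [FiniteDimensional ℝ V] [MeasurableSpace V] [BorelSpace V] [CompleteSpace E] in
/-- the orthogonal projection onto a closed `W`-invariant subspace commutes with every `W(x)`. [cite: vonNeumann1931, §5] -/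
theorem starProjection_apply_of_invariant (hW : IsWeylSystem J W) {K : Submodule ℂ E} [K.HasOrthogonalProjection]
    (hKW : ∀ (x : V), ∀ v ∈ K, W x v ∈ K) (x : V) (v : E) : K.starProjection (W x v) = W x (K.starProjection v) :=
  LatticeModel.starProjection_map_of_invariant K ⟨(W x : E →ₗ[ℂ] E), hW.norm_map x⟩ (W (-x)) (hW.apply_apply_neg x)
    (hKW x) (hKW (-x)) v

/-- **`M₀ = ℂ v₀` for a cyclic vacuum vector `v₀`**: if `v₀ ∈ M₀` and `span {W(x) v₀}` is dense, every `u ∈ M₀` is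
`(⟪v₀, u⟫ / ⟪v₀, v₀⟫) • v₀` (the coefficients `⟪W(x) v₀, u⟫ = γ(x) ⟪v₀, u⟫` are forced,
`inner_apply_of_mem_vacuumSubspace`). [cite: vonNeumann1931, §5] -/
theorem vacuum_eq_smul_of_dense_span (hW : IsWeylSystem J W) {v₀ : E} (hv₀ : v₀ ∈ hW.vacuumSubspace)
    (hd : Dense (Submodule.span ℂ (Set.range fun x : V => W x v₀) : Set E)) {u : E} (hu : u ∈ hW.vacuumSubspace) :
    u = (⟪v₀, u⟫_ℂ / ⟪v₀, v₀⟫_ℂ) • v₀ := by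
  by_cases hv : v₀ = 0
  · have htop : (⊥ : Submodule ℂ E) = ⊤ := by
      refine eq_top_of_dense_span_of_range_subset (fun x : V => W x v₀) hd
        (by rw [Submodule.bot_coe]; exact isClosed_singleton) fun x => ?_
      rw [hv, map_zero]
      exact Submodule.zero_mem _
    have hu0 : u ∈ (⊥ : Submodule ℂ E) := by rw [htop]; exact Submodule.mem_top
    rw [Submodule.mem_bot] at hu0
    rw [hu0, hv, smul_zero]
  · refine eq_smul_of_dense_span_of_inner_mul_inner (fun x : V => W x v₀) hd hv fun x => ?_
    rw [hW.inner_apply_of_mem_vacuumSubspace hv₀ hu, hW.inner_apply_of_mem_vacuumSubspace hv₀ hv₀]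
    ring

/-- **a Weyl system with a cyclic vacuum vector is irreducible**: if `v₀ ∈ M₀` and `span {W(x) v₀}` is dense, a closed
`W`-invariant subspace `K` is `⊥` or `⊤` (`P_K v₀ ∈ M₀ = ℂ v₀` since `P_K` commutes with `W`).
[cite: vonNeumann1931, §5] -/
theorem irreducible_of_dense_span_vacuum (hW : IsWeylSystem J W) {v₀ : E} (hv₀ : v₀ ∈ hW.vacuumSubspace)
    (hd : Dense (Submodule.span ℂ (Set.range fun x : V => W x v₀) : Set E)) (K : Submodule ℂ E)
    (hKc : IsClosed (K : Set E)) (hKW : ∀ (x : V), ∀ v ∈ K, W x v ∈ K) : K = ⊥ ∨ K = ⊤ := by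
  haveI : CompleteSpace K := hKc.completeSpace_coe
  haveI : K.HasOrthogonalProjection := Submodule.HasOrthogonalProjection.ofCompleteSpace K
  by_cases hvK : v₀ ∈ K
  · exact Or.inr (eq_top_of_dense_span_of_range_subset (fun x : V => W x v₀) hd hKc fun x => hKW x v₀ hvK)
  · left
    have hPM : K.starProjection v₀ ∈ hW.vacuumSubspace :=
      hW.mem_vacuumSubspace_of_commute K.starProjection (hW.starProjection_apply_of_invariant hKW) hv₀
    have hP := hW.vacuum_eq_smul_of_dense_span hv₀ hd hPM
    set c : ℂ := ⟪v₀, K.starProjection v₀⟫_ℂ / ⟪v₀, v₀⟫_ℂ with hc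
    have hc0 : c = 0 := by
      by_contra hc0
      apply hvK
      have : v₀ = c⁻¹ • K.starProjection v₀ := by rw [hP, smul_smul, inv_mul_cancel₀ hc0, one_smul]
      rw [this]
      exact K.smul_mem _ (K.starProjection_apply_mem v₀)
    have hv₀K : v₀ ∈ Kᗮ := by
      rw [← Submodule.starProjection_apply_eq_zero_iff (K := K), hP, hc0, zero_smul]
    have htop : Kᗮ = ⊤ :=
      eq_top_of_dense_span_of_range_subset (fun x : V => W x v₀) hd (Submodule.isClosed_orthogonal K)
        fun x => hW.apply_mem_orthogonal_of_invariant hKW x hv₀K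
    exact (Submodule.orthogonal_eq_top_iff (K := K)).1 htop

/-! ## §3 A Weyl system commuting with a lattice-pair Heisenberg group: a jointly cyclic vacuum lattice-fixed vector -/

section LatticePair

variable {R : Type*} [CommRing R] {X Y : Type*} [AddCommGroup X] [Module R X] [AddCommGroup Y] [Module R Y]
  [TopologicalSpace X] [TopologicalSpace Y] (β : X →ₗ[R] Y →ₗ[R] R) (ψ : AddChar R Circle)
  {B₁ : AddSubgroup X} {B₂ : AddSubgroup Y}
  (τ : Representation ℂ (Heisenberg (polar β)) E)
  (hτu : ∀ (h : Heisenberg (polar β)) (v : E), ‖τ h v‖ = ‖v‖)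
  (hτW : ∀ (h : Heisenberg (polar β)) (x : V) (v : E), τ h (W x v) = W x (τ h v))
  (hτz : ∀ (t : R) (v : E), τ (Heisenberg.ofCenter (polar β) (Multiplicative.ofAdd t)) v = ((ψ t : Circle) : ℂ) • v)
  {v₀ : E} (hτ₀ : ∀ x ∈ B₁, τ ⟨(x, 0), 0⟩ v₀ = v₀) (hμ₀ : ∀ y ∈ B₂, τ ⟨(0, y), 0⟩ v₀ = v₀)
  (hd : Dense (Submodule.span ℂ (Set.range fun p : V × Heisenberg (polar β) => W p.1 (τ p.2 v₀)) : Set E))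

include hτu hτW hτz hτ₀ hμ₀ hd

/-- **the vacuum lattice-fixed vectors form the line `ℂ v₀`** when `v₀` (vacuum and lattice-fixed) is jointly cyclic:
for `u ∈ M₀` lattice-fixed, `u = (⟪v₀, u⟫ / ⟪v₀, v₀⟫) • v₀`, since
`⟪W(x) τ(h) v₀, u⟫ = γ(x) ⟪τ(h) v₀, u⟫ = γ(x) (1_{B₁×B₂} ψ̄)(h) ⟪v₀, u⟫` (`τ(h) v₀ ∈ M₀` as `τ` commutes with `W`).
[cite: vonNeumann1931, §5; MoeglinVignerasWaldspurger1987, Chap. 2 I.6] -/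
theorem vacuum_latticeFixed_eq_smul_of_dense_span (hW : IsWeylSystem J W) (hB : IsDualLatticePair β ψ B₁ B₂)
    (hv₀ : v₀ ∈ hW.vacuumSubspace) {u : E} (hu : u ∈ hW.vacuumSubspace)
    (hτu' : ∀ x ∈ B₁, τ ⟨(x, 0), 0⟩ u = u) (hμu' : ∀ y ∈ B₂, τ ⟨(0, y), 0⟩ u = u) :
    u = (⟪v₀, u⟫_ℂ / ⟪v₀, v₀⟫_ℂ) • v₀ := by
  by_cases hv : v₀ = 0
  · have htop : (⊥ : Submodule ℂ E) = ⊤ := by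
      refine eq_top_of_dense_span_of_range_subset (fun p : V × Heisenberg (polar β) => W p.1 (τ p.2 v₀)) hd
        (by rw [Submodule.bot_coe]; exact isClosed_singleton) fun p => ?_
      rw [hv, map_zero, map_zero]
      exact Submodule.zero_mem _
    have hu0 : u ∈ (⊥ : Submodule ℂ E) := by rw [htop]; exact Submodule.mem_top
    rw [Submodule.mem_bot] at hu0
    rw [hu0, hv, smul_zero]
  · refine eq_smul_of_dense_span_of_inner_mul_inner (fun p : V × Heisenberg (polar β) => W p.1 (τ p.2 v₀)) hd hv
      fun p => ?_
    have hm : τ p.2 v₀ ∈ hW.vacuumSubspace := hW.rep_mem_vacuumSubspace τ hτu hτW p.2 hv₀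
    rw [hW.inner_apply_of_mem_vacuumSubspace hm hu, hW.inner_apply_of_mem_vacuumSubspace hm hv₀,
      inner_apply_latticeFixed_latticeFixed β ψ τ hτu hτz hτ₀ hμ₀ hτu' hμu' hB p.2,
      inner_apply_latticeFixed_latticeFixed β ψ τ hτu hτz hτ₀ hμ₀ hτ₀ hμ₀ hB p.2]
    ring

/-- **joint irreducibility from a jointly cyclic vacuum lattice-fixed vector.**  `(V, J, W)` a Weyl system on a complex
Hilbert space `E`; `τ` a representation of `Heisenberg (polar β)` on `E` by linear isometries commuting with every `W(x)`,
with central character `ψ`; `(B₁, B₂)` a dual lattice pair for `ψ(β x y)`; `v₀` a `W`-vacuum, `τ`-lattice-fixed vector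
such that `span {W(x) τ(h) v₀}` is dense.  Then a closed subspace `K` invariant under all `W(x)` and all `τ(h)` is `⊥`
or `⊤`.  (The orthogonal projection `P_K` commutes with `W` and `τ`; `P_K v₀` is vacuum and lattice-fixed, hence
`c • v₀`; `c ≠ 0 ⇒ v₀ ∈ K ⇒ K = ⊤`, `c = 0 ⇒ v₀ ∈ Kᗮ ⇒ Kᗮ = ⊤`.)
[cite: vonNeumann1931, §5; MoeglinVignerasWaldspurger1987, Chap. 2 I.6, I.8] -/
theorem irreducible_of_dense_span_vacuum_latticeFixed (hW : IsWeylSystem J W) (hB : IsDualLatticePair β ψ B₁ B₂)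
    (hv₀ : v₀ ∈ hW.vacuumSubspace) (K : Submodule ℂ E) (hKc : IsClosed (K : Set E))
    (hKW : ∀ (x : V), ∀ v ∈ K, W x v ∈ K) (hKτ : ∀ (h : Heisenberg (polar β)), ∀ v ∈ K, τ h v ∈ K) :
    K = ⊥ ∨ K = ⊤ := by
  haveI : CompleteSpace K := hKc.completeSpace_coe
  haveI : K.HasOrthogonalProjection := Submodule.HasOrthogonalProjection.ofCompleteSpace K
  by_cases hvK : v₀ ∈ K
  · exact Or.inr (eq_top_of_dense_span_of_range_subset (fun p : V × Heisenberg (polar β) => W p.1 (τ p.2 v₀)) hd hKc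
      fun p => hKW p.1 _ (hKτ p.2 v₀ hvK))
  · left
    have hPM : K.starProjection v₀ ∈ hW.vacuumSubspace :=
      hW.mem_vacuumSubspace_of_commute K.starProjection (hW.starProjection_apply_of_invariant hKW) hv₀
    have hPτ : ∀ x ∈ B₁, τ ⟨(x, 0), 0⟩ (K.starProjection v₀) = K.starProjection v₀ := fun x hx => by
      rw [← HeisenbergGroup.starProjection_apply_of_invariant β τ hτu hKτ, hτ₀ x hx]
    have hPμ : ∀ y ∈ B₂, τ ⟨(0, y), 0⟩ (K.starProjection v₀) = K.starProjection v₀ := fun y hy => by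
      rw [← HeisenbergGroup.starProjection_apply_of_invariant β τ hτu hKτ, hμ₀ y hy]
    have hP := vacuum_latticeFixed_eq_smul_of_dense_span β ψ τ hτu hτW hτz hτ₀ hμ₀ hd hW hB hv₀ hPM hPτ hPμ
    set c : ℂ := ⟪v₀, K.starProjection v₀⟫_ℂ / ⟪v₀, v₀⟫_ℂ with hc
    have hc0 : c = 0 := by
      by_contra hc0
      apply hvK
      have : v₀ = c⁻¹ • K.starProjection v₀ := by rw [hP, smul_smul, inv_mul_cancel₀ hc0, one_smul]
      rw [this]
      exact K.smul_mem _ (K.starProjection_apply_mem v₀)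
    have hv₀K : v₀ ∈ Kᗮ := by
      rw [← Submodule.starProjection_apply_eq_zero_iff (K := K), hP, hc0, zero_smul]
    have htop : Kᗮ = ⊤ :=
      eq_top_of_dense_span_of_range_subset (fun p : V × Heisenberg (polar β) => W p.1 (τ p.2 v₀)) hd
        (Submodule.isClosed_orthogonal K) fun p =>
          hW.apply_mem_orthogonal_of_invariant hKW p.1
            (HeisenbergGroup.apply_mem_orthogonal_of_invariant β τ hτu hKτ p.2 hv₀K)
    exact (Submodule.orthogonal_eq_top_iff (K := K)).1 htop

end LatticePair

end IsWeylSystem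

end Literature.RepresentationTheory.HeisenbergGroup

end
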